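import Mathlib.Topology.Algebra.Field
import Literature.NumberTheory.GaloisRepresentations.ContinuousRep
import HarnessLib

/-!
# Harris–Lan–Taylor–Thorne's group-theoretic proposition (Prop. 7.12 = Varma's Prop. 9.1)

Topic `Literature/NumberTheory/GaloisRepresentations` (vocabulary of `ContinuousRep`:
`Literature.FramedRep G A n = G →ₜ* GL (Fin n) A`, `FramedRep.charpoly`, `ContinuousRep.IsSemisimple`).

Harris–Lan–Taylor–Thorne, *On the rigid cohomology of certain Shimura varieties*, Res. Math.
Sci. 3:37 (2016), §7 (p. 225, first two paragraphs, and Prop. 7.12, p. 232), restated verbatim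
as Varma, Forum Math. Sigma 12 (2024) e21, §9, Prop. 9.1 (p. 30).  The setting, as printed
(p. 225): "let `Γ` be a topological group and let `𝔉` be a dense set of elements of `Γ`. Let
`k` be an algebraically closed, topological field of characteristic `0` and let `d ∈ ℤ_{>0}`.
Let `μ : Γ → k^×` be a continuous homomorphism such that `μ(f)` has infinite order for all
`f ∈ 𝔉`. For `f ∈ 𝔉` let `𝔈_f^1` and `𝔈_f^2` be two `d`-element multisets of elements of `k^×`.
Let `ℳ` be an infinite subset of `ℤ`. For `m ∈ ℳ` let `ρ_m : Γ → GL_{2d}(k)` be a continuous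
semi-simple representation such that for every `f ∈ 𝔉` the multiset of roots of the
characteristic polynomial of `ρ_m(f)` equals `𝔈_f^1 ⊔ 𝔈_f^2 μ(f)^m`."  The statement
(Prop. 7.12, p. 232): "Then there are continuous semi-simple representations
`ρ^i : Γ → GL_d(k)` for `i = 1, 2` such that for all `f ∈ 𝔉` the multiset of roots of the
characteristic polynomial of `ρ^i(f)` equals `𝔈_f^i`."

This is the step of the proof of HLTT's Thm. A (`Literature.NumberTheory.Automorphic.
ReciprocityGLnProofs`, lower layer 2) that isolates the `n`-dimensional `r_{p,ı}(π)` from the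
`2n`-dimensional representations `R_{p,ı}(π, N) ≅ r ⊕ r^{c,∨} ε_p^{1-2n-2N}` attached to
Eisenstein-type classes on `U(n,n)` (HLTT Cor. 6.27, Thm. 7.13; Varma Thm. 9.2): one takes
`Γ = G_{F,S}`, `k = ℚ̄_p`, `μ = ε_p^{-2}`, `𝔉` = the Frobenius elements at primes not above `S`.
Its printed proof (HLTT pp. 226–232) is invariant theory of the (possibly disconnected)
reductive Zariski closure `G` of `(μ ⊕ ⊕_m ρ_m)(Γ)`, characters of the torus `Z(G)^0` and a
combinatorial unscrewing of eigenvalue multisets (Lemma 7.1 – Cor. 7.11); Mathlib has no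
algebraic-group infrastructure for it (Zariski closures of linear groups, reductivity,
`Z(G)^0` a torus), so the proposition is vendored as a **named fact** (D-0014),
`Literature.NumberTheory.GaloisRepresentations.HarrisLanTaylorThorne2016.prop712`.

**The printed statement is not literally correct; corrected statement.**  The paper never
says that the topological field `k` is Hausdorff, but its proof uses it: p. 226, l. 8, "Note that
`ρ_M(𝔉)` is Zariski dense in `G_M`" needs Zariski-closed subsets of `k^× × GL_{2d}(k)^M` to be
closed for the topology of `k`, i.e. points of `k` closed (for a topological field: `k`
Hausdorff); the application (Thm. 7.13, p. 232) is `k = ℚ̄_p`.  Read literally (any topological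
field `k`), the statement is **false**: with the indiscrete topologies on `Γ = F_2 = ⟨a, b⟩` and on
`k = ℚ̄`, `d = 1`, `𝔉 = {a, b, ab}`, `μ(a) = μ(b) = 2`, `𝔈¹ = 𝔈² = {1}` at `a, b` and `{-1}` at
`ab`, the irreducible `ρ_m(a) = diag(1, 2^m)`, `ρ_m(b) = (p 1; s u)` with `tr = 1 + 2^m`,
`det = 2^m`, `tr(ρ_m(ab)) = -1 - 4^m` satisfy every hypothesis, while a character `χ` with
`χ(a) = χ(b) = 1` has `χ(ab) = 1 ≠ -1` — this is the theorem
`HarrisLanTaylorThorne2016.not_prop712` of `TwistedSumDecompositionProofs`.  Hence the literal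
transcription `prop712` below is kept only because dependents name it (it is refuted, so anything
proved from `(h : prop712)` is vacuous), and the named fact to USE is `prop712Hausdorff`: the same
statement with `[T2Space k]`, which is what the printed proof proves and what Thm. 7.13 applies.

Encoding.  "Continuous semi-simple representation `Γ → GL_n(k)`" = `ρ : FramedRep Γ k n` with
`ρ.toContinuousRep.IsSemisimple` (complete reducibility of the representation on `kⁿ`,
Mathlib `Representation.IsSemisimpleRepresentation`); "the multiset of roots of the
characteristic polynomial of `ρ(f)`" = `(FramedRep.charpoly ρ f).roots` (over the algebraically
closed `k` it has `n` elements); "`𝔈 μ(f)^m`" = the multiset `𝔈.map (· * μ(f)^m)` (`m ∈ ℤ`,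
power taken in `k^×`); "`μ(f)` has infinite order" = `¬ IsOfFinOrder (μ f)`; "topological
field" = `[TopologicalSpace k] [IsTopologicalDivisionRing k]`; the family `(ρ_m)_{m ∈ ℳ}` is a
function on `ℤ` constrained only at `m ∈ ℳ`.  All types in `Type` (as for the tree's Galois
groups `Field.absoluteGaloisGroup K` and coefficients `PadicAlgCl p`).

## References

* M. Harris, K.-W. Lan, R. Taylor, J. Thorne, *On the rigid cohomology of certain Shimura
  varieties*, Res. Math. Sci. 3:37 (2016), §7: p. 225 (setting), Lemma 7.1 – Cor. 7.11
  (pp. 226–231), Prop. 7.12 and Thm. 7.13 (p. 232). [HarrisLanTaylorThorneRMS2016]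
* I. Varma, *Local-global compatibility for regular algebraic cuspidal automorphic
  representations when `ℓ ≠ p`*, Forum Math. Sigma 12 (2024) e21, §9, Prop. 9.1 (p. 30).
  [VarmaFMS2024]
-/

noncomputable section

namespace Literature.NumberTheory.GaloisRepresentations

namespace HarrisLanTaylorThorne2016

/-- **WARNING: refuted as written** (`not_prop712` in `TwistedSumDecompositionProofs`: the
printed statement omits the Hausdorff hypothesis on `k` that its proof uses, p. 226 l. 8); use
`prop712Hausdorff`.  Kept verbatim because dependents name it.

**Harris–Lan–Taylor–Thorne 2016, Prop. 7.12** (= Varma 2024, Prop. 9.1), literal transcription.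
Let `Γ` be a topological group, `𝔉 ⊆ Γ` dense, `k` an algebraically closed topological field of
characteristic `0`, `d ≥ 1`, `μ : Γ → k^×` a continuous homomorphism with `μ(f)` of infinite
order for every `f ∈ 𝔉`, `𝔈¹_f, 𝔈²_f` (`f ∈ 𝔉`) `d`-element multisets of elements of `k^×`,
`ℳ ⊆ ℤ` infinite, and for `m ∈ ℳ` let `ρ_m : Γ → GL_{2d}(k)` be continuous semisimple with
roots of the characteristic polynomial of `ρ_m(f)` equal to `𝔈¹_f ⊔ 𝔈²_f μ(f)^m` for every
`f ∈ 𝔉`.  Then there are continuous semisimple `ρ¹, ρ² : Γ → GL_d(k)` such that for all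
`f ∈ 𝔉` the roots of the characteristic polynomial of `ρ^i(f)` are `𝔈^i_f` (`i = 1, 2`).
Named fact (D-0014; the printed proof is invariant theory of reductive Zariski closures, absent
from Mathlib). [cite: HarrisLanTaylorThorneRMS2016, Prop. 7.12 (p. 232), setting p. 225]
[cite: VarmaFMS2024, Prop. 9.1 (p. 30)] -/
def prop712 : Prop :=
  ∀ (Γ : Type) [Group Γ] [TopologicalSpace Γ] [IsTopologicalGroup Γ] (𝔉 : Set Γ), Dense 𝔉 →
  ∀ (k : Type) [Field k] [IsAlgClosed k] [CharZero k] [TopologicalSpace k]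
    [IsTopologicalDivisionRing k] (d : ℕ), 0 < d →
  ∀ (μ : Γ →ₜ* kˣ), (∀ f ∈ 𝔉, ¬ IsOfFinOrder (μ f)) →
  ∀ (𝔈₁ 𝔈₂ : Γ → Multiset k),
    (∀ f ∈ 𝔉, Multiset.card (𝔈₁ f) = d ∧ Multiset.card (𝔈₂ f) = d ∧
      (0 : k) ∉ 𝔈₁ f ∧ (0 : k) ∉ 𝔈₂ f) →
  ∀ (ℳ : Set ℤ), ℳ.Infinite →
  ∀ (ρ : ℤ → FramedRep Γ k (2 * d)),
    (∀ m ∈ ℳ, (ρ m).toContinuousRep.IsSemisimple) →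
    (∀ m ∈ ℳ, ∀ f ∈ 𝔉, (FramedRep.charpoly (ρ m) f).roots =
      𝔈₁ f + (𝔈₂ f).map (· * (((μ f) ^ m : kˣ) : k))) →
  ∃ (ρ₁ ρ₂ : FramedRep Γ k d),
    ρ₁.toContinuousRep.IsSemisimple ∧ ρ₂.toContinuousRep.IsSemisimple ∧
    ∀ f ∈ 𝔉, (FramedRep.charpoly ρ₁ f).roots = 𝔈₁ f ∧ (FramedRep.charpoly ρ₂ f).roots = 𝔈₂ f

/-- The conclusion of Prop. 7.12 for the first factor alone, in the frequently used shape
"`∃ ρ¹` continuous semisimple of dimension `d` with prescribed Frobenius roots" (projection of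
the named fact). [cite: HarrisLanTaylorThorneRMS2016, Prop. 7.12 (p. 232)] -/
theorem prop712.exists_fst (h : prop712)
    {Γ : Type} [Group Γ] [TopologicalSpace Γ] [IsTopologicalGroup Γ] {𝔉 : Set Γ} (h𝔉 : Dense 𝔉)
    {k : Type} [Field k] [IsAlgClosed k] [CharZero k] [TopologicalSpace k]
    [IsTopologicalDivisionRing k] {d : ℕ} (hd : 0 < d)
    (μ : Γ →ₜ* kˣ) (hμ : ∀ f ∈ 𝔉, ¬ IsOfFinOrder (μ f))
    (𝔈₁ 𝔈₂ : Γ → Multiset k)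
    (h𝔈 : ∀ f ∈ 𝔉, Multiset.card (𝔈₁ f) = d ∧ Multiset.card (𝔈₂ f) = d ∧
      (0 : k) ∉ 𝔈₁ f ∧ (0 : k) ∉ 𝔈₂ f)
    {ℳ : Set ℤ} (hℳ : ℳ.Infinite) (ρ : ℤ → FramedRep Γ k (2 * d))
    (hss : ∀ m ∈ ℳ, (ρ m).toContinuousRep.IsSemisimple)
    (hρ : ∀ m ∈ ℳ, ∀ f ∈ 𝔉, (FramedRep.charpoly (ρ m) f).roots =
      𝔈₁ f + (𝔈₂ f).map (· * (((μ f) ^ m : kˣ) : k))) :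
    ∃ ρ₁ : FramedRep Γ k d, ρ₁.toContinuousRep.IsSemisimple ∧
      ∀ f ∈ 𝔉, (FramedRep.charpoly ρ₁ f).roots = 𝔈₁ f := by
  obtain ⟨ρ₁, ρ₂, h₁, -, hF⟩ := h Γ 𝔉 h𝔉 k d hd μ hμ 𝔈₁ 𝔈₂ h𝔈 ℳ hℳ ρ hss hρ
  exact ⟨ρ₁, h₁, fun f hf ↦ (hF f hf).1⟩

/-- **Harris–Lan–Taylor–Thorne 2016, Prop. 7.12** (= Varma 2024, Prop. 9.1), **corrected
statement**: the literal transcription `prop712` with the one hypothesis added that the printed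
proof uses and the printed statement omits — the topological field `k` is Hausdorff (`[T2Space k]`;
p. 226, l. 8 "`ρ_M(𝔉)` is Zariski dense in `G_M`" requires Zariski-closed sets of `k`-points to be
closed in the `k`-topology, i.e. `{0}` closed in `k`; Thm. 7.13 applies the proposition with
`k = ℚ̄_p`).  Without it the statement is false (`not_prop712`, `TwistedSumDecompositionProofs`).
Statement: `Γ` a topological group, `𝔉 ⊆ Γ` dense, `k` an algebraically closed **Hausdorff**
topological field of characteristic `0`, `d ≥ 1`, `μ : Γ → k^×` a continuous homomorphism with
`μ(f)` of infinite order for every `f ∈ 𝔉`, `𝔈¹_f, 𝔈²_f` (`f ∈ 𝔉`) `d`-element multisets of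
elements of `k^×`, `ℳ ⊆ ℤ` infinite, and for `m ∈ ℳ`, `ρ_m : Γ → GL_{2d}(k)` continuous semisimple
with roots of the characteristic polynomial of `ρ_m(f)` equal to `𝔈¹_f ⊔ 𝔈²_f μ(f)^m` for every
`f ∈ 𝔉`; then there are continuous semisimple `ρ¹, ρ² : Γ → GL_d(k)` such that for all `f ∈ 𝔉`
the roots of the characteristic polynomial of `ρ^i(f)` are `𝔈^i_f` (`i = 1, 2`).  Named fact
(D-0014): the printed proof (pp. 226–232: the reductive Zariski closure `G` of
`(μ ⊕ ⊕_m ρ_m)(Γ)`, characters of the torus `Z(G⁰)⁰`, Lemma 7.1 – Cor. 7.11) needs linear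
algebraic groups over `k`, absent from Mathlib.
[cite: HarrisLanTaylorThorneRMS2016, Prop. 7.12 (p. 232), setting p. 225, proof pp. 226–232]
[cite: VarmaFMS2024, Prop. 9.1 (p. 30)] -/
def prop712Hausdorff : Prop :=
  ∀ (Γ : Type) [Group Γ] [TopologicalSpace Γ] [IsTopologicalGroup Γ] (𝔉 : Set Γ), Dense 𝔉 →
  ∀ (k : Type) [Field k] [IsAlgClosed k] [CharZero k] [TopologicalSpace k]
    [IsTopologicalDivisionRing k] [T2Space k] (d : ℕ), 0 < d →
  ∀ (μ : Γ →ₜ* kˣ), (∀ f ∈ 𝔉, ¬ IsOfFinOrder (μ f)) →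
  ∀ (𝔈₁ 𝔈₂ : Γ → Multiset k),
    (∀ f ∈ 𝔉, Multiset.card (𝔈₁ f) = d ∧ Multiset.card (𝔈₂ f) = d ∧
      (0 : k) ∉ 𝔈₁ f ∧ (0 : k) ∉ 𝔈₂ f) →
  ∀ (ℳ : Set ℤ), ℳ.Infinite →
  ∀ (ρ : ℤ → FramedRep Γ k (2 * d)),
    (∀ m ∈ ℳ, (ρ m).toContinuousRep.IsSemisimple) →
    (∀ m ∈ ℳ, ∀ f ∈ 𝔉, (FramedRep.charpoly (ρ m) f).roots =
      𝔈₁ f + (𝔈₂ f).map (· * (((μ f) ^ m : kˣ) : k))) →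
  ∃ (ρ₁ ρ₂ : FramedRep Γ k d),
    ρ₁.toContinuousRep.IsSemisimple ∧ ρ₂.toContinuousRep.IsSemisimple ∧
    ∀ f ∈ 𝔉, (FramedRep.charpoly ρ₁ f).roots = 𝔈₁ f ∧ (FramedRep.charpoly ρ₂ f).roots = 𝔈₂ f

/-- The corrected fact is formally weaker than the literal transcription: `prop712` (all
topological fields) implies `prop712Hausdorff` (Hausdorff ones) by specialisation.  (Since
`prop712` is refuted this is only a record of the logical relation between the two names.)
[cite: HarrisLanTaylorThorneRMS2016, Prop. 7.12 (p. 232)] -/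
theorem prop712Hausdorff_of_prop712 (h : prop712) : prop712Hausdorff :=
  fun Γ _ _ _ 𝔉 h𝔉 k _ _ _ _ _ _ d hd μ hμ 𝔈₁ 𝔈₂ h𝔈 ℳ hℳ ρ hss hρ ↦
    h Γ 𝔉 h𝔉 k d hd μ hμ 𝔈₁ 𝔈₂ h𝔈 ℳ hℳ ρ hss hρ

/-- The conclusion of the corrected Prop. 7.12 for the first factor alone: "`∃ ρ¹` continuous
semisimple of dimension `d` with prescribed Frobenius roots" over a Hausdorff `k` (projection of
the named fact `prop712Hausdorff`; this is the shape Thm. 7.13 consumes, with `k = ℚ̄_p`).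
[cite: HarrisLanTaylorThorneRMS2016, Prop. 7.12 (p. 232)] -/
theorem prop712Hausdorff.exists_fst (h : prop712Hausdorff)
    {Γ : Type} [Group Γ] [TopologicalSpace Γ] [IsTopologicalGroup Γ] {𝔉 : Set Γ} (h𝔉 : Dense 𝔉)
    {k : Type} [Field k] [IsAlgClosed k] [CharZero k] [TopologicalSpace k]
    [IsTopologicalDivisionRing k] [T2Space k] {d : ℕ} (hd : 0 < d)
    (μ : Γ →ₜ* kˣ) (hμ : ∀ f ∈ 𝔉, ¬ IsOfFinOrder (μ f))
    (𝔈₁ 𝔈₂ : Γ → Multiset k)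
    (h𝔈 : ∀ f ∈ 𝔉, Multiset.card (𝔈₁ f) = d ∧ Multiset.card (𝔈₂ f) = d ∧
      (0 : k) ∉ 𝔈₁ f ∧ (0 : k) ∉ 𝔈₂ f)
    {ℳ : Set ℤ} (hℳ : ℳ.Infinite) (ρ : ℤ → FramedRep Γ k (2 * d))
    (hss : ∀ m ∈ ℳ, (ρ m).toContinuousRep.IsSemisimple)
    (hρ : ∀ m ∈ ℳ, ∀ f ∈ 𝔉, (FramedRep.charpoly (ρ m) f).roots =
      𝔈₁ f + (𝔈₂ f).map (· * (((μ f) ^ m : kˣ) : k))) :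
    ∃ ρ₁ : FramedRep Γ k d, ρ₁.toContinuousRep.IsSemisimple ∧
      ∀ f ∈ 𝔉, (FramedRep.charpoly ρ₁ f).roots = 𝔈₁ f := by
  obtain ⟨ρ₁, ρ₂, h₁, -, hF⟩ := h Γ 𝔉 h𝔉 k d hd μ hμ 𝔈₁ 𝔈₂ h𝔈 ℳ hℳ ρ hss hρ
  exact ⟨ρ₁, h₁, fun f hf ↦ (hF f hf).1⟩

/-- Symmetrically, the conclusion of the corrected Prop. 7.12 for the second factor alone.
[cite: HarrisLanTaylorThorneRMS2016, Prop. 7.12 (p. 232)] -/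
theorem prop712Hausdorff.exists_snd (h : prop712Hausdorff)
    {Γ : Type} [Group Γ] [TopologicalSpace Γ] [IsTopologicalGroup Γ] {𝔉 : Set Γ} (h𝔉 : Dense 𝔉)
    {k : Type} [Field k] [IsAlgClosed k] [CharZero k] [TopologicalSpace k]
    [IsTopologicalDivisionRing k] [T2Space k] {d : ℕ} (hd : 0 < d)
    (μ : Γ →ₜ* kˣ) (hμ : ∀ f ∈ 𝔉, ¬ IsOfFinOrder (μ f))
    (𝔈₁ 𝔈₂ : Γ → Multiset k)
    (h𝔈 : ∀ f ∈ 𝔉, Multiset.card (𝔈₁ f) = d ∧ Multiset.card (𝔈₂ f) = d ∧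
      (0 : k) ∉ 𝔈₁ f ∧ (0 : k) ∉ 𝔈₂ f)
    {ℳ : Set ℤ} (hℳ : ℳ.Infinite) (ρ : ℤ → FramedRep Γ k (2 * d))
    (hss : ∀ m ∈ ℳ, (ρ m).toContinuousRep.IsSemisimple)
    (hρ : ∀ m ∈ ℳ, ∀ f ∈ 𝔉, (FramedRep.charpoly (ρ m) f).roots =
      𝔈₁ f + (𝔈₂ f).map (· * (((μ f) ^ m : kˣ) : k))) :
    ∃ ρ₂ : FramedRep Γ k d, ρ₂.toContinuousRep.IsSemisimple ∧
      ∀ f ∈ 𝔉, (FramedRep.charpoly ρ₂ f).roots = 𝔈₂ f := by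
  obtain ⟨ρ₁, ρ₂, -, h₂, hF⟩ := h Γ 𝔉 h𝔉 k d hd μ hμ 𝔈₁ 𝔈₂ h𝔈 ℳ hℳ ρ hss hρ
  exact ⟨ρ₂, h₂, fun f hf ↦ (hF f hf).2⟩

end HarrisLanTaylorThorne2016

end Literature.NumberTheory.GaloisRepresentations
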